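import Mathlib
import Literature.NumberTheory.Transcendental.SqrtSevenLValueIdentityProofs
import HarnessLib

/-!
# `ZagierDilogarithmConjecture` (stmt-KontsevichZagierPeriods-10550) — line `kummer-clausen-linearisation` (c2), stub `stub_heptagonalCertificate`: `ZagierDilogarithmConjecture` (stmt-KontsevichZagierPeriods-10550) — line
`kummer-clausen-linearisation` (c2), heptagonal instance, piece W3:
cyclotomic coordinates and the Galois-symmetry certificate

Let `ζ = exp(2πi/7)` and consider the five points
`z = (ζ, ζ², ζ³, X, Y)`, `X = 1 + ζ + ζ² + ζ⁴`, `Y = (ζ + ζ² + ζ⁴)/2`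
(`X = (1 + √−7)/2`, `Y = (−1 + √−7)/4`) with coefficients `n = (7, 7, −7, −8, −4)`: the formal
combination `Σ nᵢ [zᵢ]` is the heptagonal relation
`7 (D(ζ) + D(ζ²) − D(ζ³)) = 8 D(X) + 4 D(Y)` for the Bloch–Wigner dilogarithm.
This file supplies the two combinatorial inputs of the lead's slice theorem
`stub_cyclotomicSignedSlice` (`N = 7`, `k = 5`):

* `hept_coords`: `zᵢ = Σₘ qᵢₘ ζᵐ` for the explicit rational `5 × 7` matrix `q`;
* `hept_certificate`: for every `j` coprime to `7` the twisted family `(Σₘ qᵢₘ ζ^{jm})ᵢ`, i.e.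
  `(ζʲ, ζ²ʲ, ζ³ʲ, 1 + ζʲ + ζ²ʲ + ζ⁴ʲ, (ζʲ + ζ²ʲ + ζ⁴ʲ)/2)`, is a signed permutation of `(zᵢ)` resp.
  `(z̄ᵢ)` compatible with the coefficients: there are `e = ±1` and `π ∈ S₅` with, for each `i`,
  either `twistᵢ = z_{π i}` and `nᵢ = e n_{π i}`, or `twistᵢ = conj z_{π i}` and `nᵢ = −e n_{π i}`.

The six certificates (`j mod 7`; `π` as the list `(π 0, …, π 4)`):
`1 ↦ (e, π) = (1, id)`, `2 ↦ (1, (1,2,0,3,4))`, `4 ↦ (1, (2,0,1,3,4))`,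
`6 ↦ (−1, id)`, `5 ↦ (−1, (1,2,0,3,4))`, `3 ↦ (−1, (2,0,1,3,4))`
(`j ≡ 1, 2, 4` are the squares mod `7`, fixing `ℚ(√−7) ∋ X, Y`; the non-squares conjugate them).
All point identities are monomial: equalities of sums of powers of `ζ` after reducing exponents
modulo `7` (`ζ⁷ = 1`, `conj ζ = ζ⁶`); the minimal polynomial of `ζ` is never used.

Proof layout: the certificate is first proved for an abstract `ζ : ℂ` with `ζ ^ 7 = 1` and
`conj ζ = ζ ^ 6` (`hept_W3_cert`, thirty mechanical cases: the decidable coefficient condition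
selects the branch, `simp` reduces exponents, `ring` closes), then specialised to
`ζ = exp(2πi/7)` after reducing `j` to `j % 7 ∈ {1, …, 6}`.
Mathlib only; sorry-free; axioms ⊆ {propext, Classical.choice, Quot.sound}.
-/

noncomputable section

open scoped BigOperators ComplexConjugate

namespace Summit.KontsevichZagierPeriods.HyperbolicBloch.ZagierDilogarithmGaloisDescent

/-- `ζ = exp(2πi/7)` satisfies `ζ ^ 7 = 1`. [folklore] -/
theorem hept_W3_pow_seven : Complex.exp (2 * Real.pi * Complex.I / 7) ^ 7 = 1 := by
  have h : IsPrimitiveRoot (Complex.exp (2 * Real.pi * Complex.I / 7)) 7 :=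
    Complex.isPrimitiveRoot_exp 7 (by norm_num)
  exact h.pow_eq_one

/-- Exponents of `ζ = exp(2πi/7)` only matter modulo `7`: `ζ ^ a = ζ ^ (a % 7)`. [folklore] -/
theorem hept_W3_pow_mod (a : ℕ) :
    Complex.exp (2 * Real.pi * Complex.I / 7) ^ a =
      Complex.exp (2 * Real.pi * Complex.I / 7) ^ (a % 7) := by
  conv_lhs => rw [← Nat.mod_add_div a 7, pow_add, pow_mul, hept_W3_pow_seven, one_pow, mul_one]

/-- Twisted exponents: `ζ ^ (j m) = (ζ ^ (j % 7)) ^ m` for `ζ = exp(2πi/7)`. [folklore] -/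
theorem hept_W3_pow_mul_mod (j m : ℕ) :
    Complex.exp (2 * Real.pi * Complex.I / 7) ^ (j * m) =
      (Complex.exp (2 * Real.pi * Complex.I / 7) ^ (j % 7)) ^ m := by
  rw [← pow_mul, hept_W3_pow_mod (j * m), hept_W3_pow_mod (j % 7 * m), Nat.mod_mul_mod]

/-- Evaluation of the coordinate sums: for any `w : ℂ` and the heptagonal coordinate matrix `q`,
`(Σₘ qᵢₘ wᵐ)ᵢ = (w, w², w³, 1 + w + w² + w⁴, (w + w² + w⁴)/2)`. [folklore] -/
theorem hept_W3_sum (w : ℂ) (i : Fin 5) :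
    ∑ m : Fin 7, ((![![0, 1, 0, 0, 0, 0, 0], ![0, 0, 1, 0, 0, 0, 0], ![0, 0, 0, 1, 0, 0, 0],
        ![1, 1, 1, 0, 1, 0, 0], ![0, 1/2, 1/2, 0, 1/2, 0, 0]] : Fin 5 → Fin 7 → ℚ) i m : ℂ) *
          w ^ (m : ℕ) =
      (![w, w ^ 2, w ^ 3, 1 + w + w ^ 2 + w ^ 4, (w + w ^ 2 + w ^ 4) / 2] : Fin 5 → ℂ) i := by
  fin_cases i <;> simp [Fin.sum_univ_succ] <;> ring

/-- The `j`-twisted coordinate sums for `ζ = exp(2πi/7)`: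
`(Σₘ qᵢₘ ζ^{jm})ᵢ = (w, w², w³, 1 + w + w² + w⁴, (w + w² + w⁴)/2)` with `w = ζ ^ (j % 7)`.
[folklore] -/
theorem hept_W3_twist (j : ℕ) (i : Fin 5) :
    ∑ m : Fin 7, ((![![0, 1, 0, 0, 0, 0, 0], ![0, 0, 1, 0, 0, 0, 0], ![0, 0, 0, 1, 0, 0, 0],
        ![1, 1, 1, 0, 1, 0, 0], ![0, 1/2, 1/2, 0, 1/2, 0, 0]] : Fin 5 → Fin 7 → ℚ) i m : ℂ) *
          Complex.exp (2 * Real.pi * Complex.I / 7) ^ (j * (m : ℕ)) =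
      (![Complex.exp (2 * Real.pi * Complex.I / 7) ^ (j % 7),
         (Complex.exp (2 * Real.pi * Complex.I / 7) ^ (j % 7)) ^ 2,
         (Complex.exp (2 * Real.pi * Complex.I / 7) ^ (j % 7)) ^ 3,
         1 + Complex.exp (2 * Real.pi * Complex.I / 7) ^ (j % 7) +
           (Complex.exp (2 * Real.pi * Complex.I / 7) ^ (j % 7)) ^ 2 +
           (Complex.exp (2 * Real.pi * Complex.I / 7) ^ (j % 7)) ^ 4,
         (Complex.exp (2 * Real.pi * Complex.I / 7) ^ (j % 7) +
           (Complex.exp (2 * Real.pi * Complex.I / 7) ^ (j % 7)) ^ 2 +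
           (Complex.exp (2 * Real.pi * Complex.I / 7) ^ (j % 7)) ^ 4) / 2] : Fin 5 → ℂ) i := by
  rw [← hept_W3_sum]
  exact Finset.sum_congr rfl fun m _ => by rw [hept_W3_pow_mul_mod]

/-- **The six signed-permutation certificates, abstract form.** For `ζ : ℂ` with `ζ ^ 7 = 1` and
`conj ζ = ζ ^ 6`, points `z = (ζ, ζ², ζ³, 1 + ζ + ζ² + ζ⁴, (ζ + ζ² + ζ⁴)/2)`, coefficients
`n = (7, 7, −7, −8, −4)` and every `r ∈ {1, …, 6}`, the `r`-twisted family
`(w, w², w³, 1 + w + w² + w⁴, (w + w² + w⁴)/2)`, `w = ζ ^ r`, is a signed permutation of `z`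
resp. `conj z` compatible with `n`: witnesses `(e, π)` = `(1, id)`, `(1, (1,2,0,3,4))`,
`(−1, (2,0,1,3,4))`, `(1, (2,0,1,3,4))`, `(−1, (1,2,0,3,4))`, `(−1, id)` for `r = 1, …, 6`.
[folklore] -/
theorem hept_W3_cert (ζ : ℂ) (h7 : ζ ^ 7 = 1) (hc : conj ζ = ζ ^ 6) (r : ℕ)
    (hr : r = 1 ∨ r = 2 ∨ r = 3 ∨ r = 4 ∨ r = 5 ∨ r = 6) :
    ∃ (e : ℤ) (π : Equiv.Perm (Fin 5)), ∀ i : Fin 5,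
      ((![ζ ^ r, (ζ ^ r) ^ 2, (ζ ^ r) ^ 3, 1 + ζ ^ r + (ζ ^ r) ^ 2 + (ζ ^ r) ^ 4,
          (ζ ^ r + (ζ ^ r) ^ 2 + (ζ ^ r) ^ 4) / 2] : Fin 5 → ℂ) i =
          (![ζ, ζ ^ 2, ζ ^ 3, 1 + ζ + ζ ^ 2 + ζ ^ 4, (ζ + ζ ^ 2 + ζ ^ 4) / 2] : Fin 5 → ℂ) (π i) ∧
        (![7, 7, -7, -8, -4] : Fin 5 → ℤ) i = e * (![7, 7, -7, -8, -4] : Fin 5 → ℤ) (π i)) ∨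
      ((![ζ ^ r, (ζ ^ r) ^ 2, (ζ ^ r) ^ 3, 1 + ζ ^ r + (ζ ^ r) ^ 2 + (ζ ^ r) ^ 4,
          (ζ ^ r + (ζ ^ r) ^ 2 + (ζ ^ r) ^ 4) / 2] : Fin 5 → ℂ) i =
          conj ((![ζ, ζ ^ 2, ζ ^ 3, 1 + ζ + ζ ^ 2 + ζ ^ 4, (ζ + ζ ^ 2 + ζ ^ 4) / 2] : Fin 5 → ℂ)
            (π i)) ∧
        (![7, 7, -7, -8, -4] : Fin 5 → ℤ) i = -(e * (![7, 7, -7, -8, -4] : Fin 5 → ℤ) (π i))) := by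
  -- exponents are reduced modulo `7`
  have hstep : ∀ a : ℕ, ζ ^ (a + 7) = ζ ^ a := fun a => by rw [pow_add, h7, mul_one]
  -- the six Galois twists, each with its sign `e` and permutation `π`
  rcases hr with rfl | rfl | rfl | rfl | rfl | rfl
  on_goal 1 => refine ⟨1, Equiv.refl _, ?_⟩
  on_goal 2 => refine ⟨1, ⟨![1, 2, 0, 3, 4], ![2, 0, 1, 3, 4], by decide, by decide⟩, ?_⟩
  on_goal 3 => refine ⟨-1, ⟨![2, 0, 1, 3, 4], ![1, 2, 0, 3, 4], by decide, by decide⟩, ?_⟩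
  on_goal 4 => refine ⟨1, ⟨![2, 0, 1, 3, 4], ![1, 2, 0, 3, 4], by decide, by decide⟩, ?_⟩
  on_goal 5 => refine ⟨-1, ⟨![1, 2, 0, 3, 4], ![2, 0, 1, 3, 4], by decide, by decide⟩, ?_⟩
  on_goal 6 => refine ⟨-1, Equiv.refl _, ?_⟩
  all_goals
    intro i
    fin_cases i
  -- the (decidable) coefficient condition selects the branch
  all_goals
    first
    | refine Or.inl ⟨?_, by decide⟩
    | refine Or.inr ⟨?_, by decide⟩
  -- the point condition is a monomial identity modulo `ζ ^ 7 = 1`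
  all_goals
    simp only [Fin.reduceFinMk, Fin.isValue, Matrix.cons_val, Equiv.coe_fn_mk, Equiv.refl_apply,
      map_add, map_pow, map_one, map_div₀, map_ofNat, hc, ← pow_mul, Nat.reduceMul, hstep, pow_one]
  all_goals ring

/-- **`hept_coords` (cyclotomic coordinates of the heptagonal points).** With `ζ = exp(2πi/7)`,
the points `(ζ, ζ², ζ³, 1 + ζ + ζ² + ζ⁴, (ζ + ζ² + ζ⁴)/2)` are `Σₘ qᵢₘ ζᵐ` for the rational matrix
`q = (e₁; e₂; e₃; 1,1,1,0,1,0,0; 0,½,½,0,½,0,0)` (rows indexed by the point, columns by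
`m = 0, …, 6`). [folklore] -/
theorem hept_coords : ∀ i : Fin 5,
    (![Complex.exp (2 * Real.pi * Complex.I / 7), Complex.exp (2 * Real.pi * Complex.I / 7) ^ 2,
       Complex.exp (2 * Real.pi * Complex.I / 7) ^ 3,
       1 + Complex.exp (2 * Real.pi * Complex.I / 7) +
         Complex.exp (2 * Real.pi * Complex.I / 7) ^ 2 +
         Complex.exp (2 * Real.pi * Complex.I / 7) ^ 4,
       (Complex.exp (2 * Real.pi * Complex.I / 7) + Complex.exp (2 * Real.pi * Complex.I / 7) ^ 2 +
         Complex.exp (2 * Real.pi * Complex.I / 7) ^ 4) / 2] : Fin 5 → ℂ) i =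
      ∑ m : Fin 7, ((![![0, 1, 0, 0, 0, 0, 0], ![0, 0, 1, 0, 0, 0, 0], ![0, 0, 0, 1, 0, 0, 0],
        ![1, 1, 1, 0, 1, 0, 0], ![0, 1/2, 1/2, 0, 1/2, 0, 0]] : Fin 5 → Fin 7 → ℚ) i m : ℂ) *
          Complex.exp (2 * Real.pi * Complex.I / 7) ^ (m : ℕ) :=
  fun i => (hept_W3_sum _ i).symm

/-- **`hept_certificate` (Galois-symmetry certificate of the heptagonal relation).** With
`ζ = exp(2πi/7)`, `z = (ζ, ζ², ζ³, 1 + ζ + ζ² + ζ⁴, (ζ + ζ² + ζ⁴)/2)`, `n = (7, 7, −7, −8, −4)`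
and the coordinate matrix `q` of `hept_coords`: for every `j` coprime to `7` there are `e ∈ ℤ` and a
permutation `π` of the indices such that for each `i` the twisted point `Σₘ qᵢₘ ζ^{jm}` is
`z_{π i}` with `nᵢ = e n_{π i}`, or `conj z_{π i}` with `nᵢ = −e n_{π i}` — the orbit-symmetry
hypothesis of `stub_cyclotomicSignedSlice` for `N = 7`, `k = 5`. (Reduce `j` to
`j % 7 ∈ {1, …, 6}` and apply `hept_W3_cert`.) [folklore] -/
theorem hept_certificate : ∀ j : ℕ, j.Coprime 7 → ∃ (e : ℤ) (π : Equiv.Perm (Fin 5)), ∀ i : Fin 5,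
    ((∑ m : Fin 7, ((![![0, 1, 0, 0, 0, 0, 0], ![0, 0, 1, 0, 0, 0, 0], ![0, 0, 0, 1, 0, 0, 0],
        ![1, 1, 1, 0, 1, 0, 0], ![0, 1/2, 1/2, 0, 1/2, 0, 0]] : Fin 5 → Fin 7 → ℚ) i m : ℂ) *
          Complex.exp (2 * Real.pi * Complex.I / 7) ^ (j * (m : ℕ))) =
        (![Complex.exp (2 * Real.pi * Complex.I / 7), Complex.exp (2 * Real.pi * Complex.I / 7) ^ 2,
           Complex.exp (2 * Real.pi * Complex.I / 7) ^ 3,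
           1 + Complex.exp (2 * Real.pi * Complex.I / 7) +
             Complex.exp (2 * Real.pi * Complex.I / 7) ^ 2 +
             Complex.exp (2 * Real.pi * Complex.I / 7) ^ 4,
           (Complex.exp (2 * Real.pi * Complex.I / 7) +
             Complex.exp (2 * Real.pi * Complex.I / 7) ^ 2 +
             Complex.exp (2 * Real.pi * Complex.I / 7) ^ 4) / 2] : Fin 5 → ℂ) (π i) ∧
      (![7, 7, -7, -8, -4] : Fin 5 → ℤ) i = e * (![7, 7, -7, -8, -4] : Fin 5 → ℤ) (π i)) ∨
    ((∑ m : Fin 7, ((![![0, 1, 0, 0, 0, 0, 0], ![0, 0, 1, 0, 0, 0, 0], ![0, 0, 0, 1, 0, 0, 0],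
        ![1, 1, 1, 0, 1, 0, 0], ![0, 1/2, 1/2, 0, 1/2, 0, 0]] : Fin 5 → Fin 7 → ℚ) i m : ℂ) *
          Complex.exp (2 * Real.pi * Complex.I / 7) ^ (j * (m : ℕ))) =
        conj ((![Complex.exp (2 * Real.pi * Complex.I / 7),
           Complex.exp (2 * Real.pi * Complex.I / 7) ^ 2,
           Complex.exp (2 * Real.pi * Complex.I / 7) ^ 3,
           1 + Complex.exp (2 * Real.pi * Complex.I / 7) +
             Complex.exp (2 * Real.pi * Complex.I / 7) ^ 2 +
             Complex.exp (2 * Real.pi * Complex.I / 7) ^ 4,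
           (Complex.exp (2 * Real.pi * Complex.I / 7) +
             Complex.exp (2 * Real.pi * Complex.I / 7) ^ 2 +
             Complex.exp (2 * Real.pi * Complex.I / 7) ^ 4) / 2] : Fin 5 → ℂ) (π i)) ∧
      (![7, 7, -7, -8, -4] : Fin 5 → ℤ) i = -(e * (![7, 7, -7, -8, -4] : Fin 5 → ℤ) (π i))) := by
  intro j hj
  -- `j` coprime to `7` has residue `1, …, 6`
  have hr : j % 7 = 1 ∨ j % 7 = 2 ∨ j % 7 = 3 ∨ j % 7 = 4 ∨ j % 7 = 5 ∨ j % 7 = 6 := by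
    have h0 : j % 7 ≠ 0 := fun h0 =>
      Nat.not_coprime_of_dvd_of_dvd (by norm_num) (Nat.dvd_of_mod_eq_zero h0) dvd_rfl hj
    omega
  obtain ⟨e, π, h⟩ := hept_W3_cert (Complex.exp (2 * Real.pi * Complex.I / 7)) hept_W3_pow_seven
    Literature.NumberTheory.Transcendental.SqrtSeven.zeta7_conj (j % 7) hr
  refine ⟨e, π, fun i => ?_⟩
  rw [hept_W3_twist]
  exact h i


/-- **Registered stub `stub_heptagonalCertificate`** (= `hept_certificate`): the signed Galois certificate of
the heptagonal relation, input of `stub_cyclotomicSignedSlice` (`N = 7`, `k = 5`). [folklore] -/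
theorem stub_heptagonalCertificate :
    ∀ j : ℕ, j.Coprime 7 → ∃ (e : ℤ) (π : Equiv.Perm (Fin 5)), ∀ i : Fin 5,
    ((∑ m : Fin 7, ((![![0, 1, 0, 0, 0, 0, 0], ![0, 0, 1, 0, 0, 0, 0], ![0, 0, 0, 1, 0, 0, 0],
        ![1, 1, 1, 0, 1, 0, 0], ![0, 1/2, 1/2, 0, 1/2, 0, 0]] : Fin 5 → Fin 7 → ℚ) i m : ℂ) *
          Complex.exp (2 * Real.pi * Complex.I / 7) ^ (j * (m : ℕ))) =
        (![Complex.exp (2 * Real.pi * Complex.I / 7), Complex.exp (2 * Real.pi * Complex.I / 7) ^ 2,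
           Complex.exp (2 * Real.pi * Complex.I / 7) ^ 3,
           1 + Complex.exp (2 * Real.pi * Complex.I / 7) + Complex.exp (2 * Real.pi * Complex.I / 7) ^ 2 +
             Complex.exp (2 * Real.pi * Complex.I / 7) ^ 4,
           (Complex.exp (2 * Real.pi * Complex.I / 7) + Complex.exp (2 * Real.pi * Complex.I / 7) ^ 2 +
             Complex.exp (2 * Real.pi * Complex.I / 7) ^ 4) / 2] : Fin 5 → ℂ) (π i) ∧
      (![7, 7, -7, -8, -4] : Fin 5 → ℤ) i = e * (![7, 7, -7, -8, -4] : Fin 5 → ℤ) (π i)) ∨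
    ((∑ m : Fin 7, ((![![0, 1, 0, 0, 0, 0, 0], ![0, 0, 1, 0, 0, 0, 0], ![0, 0, 0, 1, 0, 0, 0],
        ![1, 1, 1, 0, 1, 0, 0], ![0, 1/2, 1/2, 0, 1/2, 0, 0]] : Fin 5 → Fin 7 → ℚ) i m : ℂ) *
          Complex.exp (2 * Real.pi * Complex.I / 7) ^ (j * (m : ℕ))) =
        conj ((![Complex.exp (2 * Real.pi * Complex.I / 7), Complex.exp (2 * Real.pi * Complex.I / 7) ^ 2,
           Complex.exp (2 * Real.pi * Complex.I / 7) ^ 3,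
           1 + Complex.exp (2 * Real.pi * Complex.I / 7) + Complex.exp (2 * Real.pi * Complex.I / 7) ^ 2 +
             Complex.exp (2 * Real.pi * Complex.I / 7) ^ 4,
           (Complex.exp (2 * Real.pi * Complex.I / 7) + Complex.exp (2 * Real.pi * Complex.I / 7) ^ 2 +
             Complex.exp (2 * Real.pi * Complex.I / 7) ^ 4) / 2] : Fin 5 → ℂ) (π i)) ∧
      (![7, 7, -7, -8, -4] : Fin 5 → ℤ) i = -(e * (![7, 7, -7, -8, -4] : Fin 5 → ℤ) (π i))) :=
  hept_certificate

end Summit.KontsevichZagierPeriods.HyperbolicBloch.ZagierDilogarithmGaloisDescent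

end
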